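import Summits.AtomisticToContinuum.HydrodynamicLimit.Theses.JParityClosure
import Literature.MathematicalPhysics.KineticTheory.HardSphereEulerLLN
import Literature.Analysis.FluidPDE.HardSphereDynamicsProofs
import Literature.Analysis.FluidPDE.HardSphereTorusMeasure

/-!
# A-priori structure of the `LocalSecondLaw` entropy functional

Negative-knowledge support for the crux `JParityClosure.LocalSecondLaw` (stmt-AtomisticToContinuum-13081), from
the standing disprover's `Cruxes/LocalSecondLaw/Disproof.lean` §(b).  The pieces of the crux functional as named
definitions (`cone`, `rhoC`, `momC`, `kinC`, `thetaC`, `Hs`, `entropyFunctional` — DEFINITIONALLY the crux's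
`let`-tower, so `change` rewrites the crux event through them) and the one-sided a-priori bounds every seat can
use: `hsExcessFreeEnergy_nonneg : 0 ≤ f_ex`; `Hs_ge : H(ρ_r,θ_r) ≥ -1 - e_r` pointwise, guard included;
`integral_cone_le : ∫ b_r ≤ 4` (`0 < r < 1/2`, exact Haar volume of minimal-image balls); `integral_kinC_le :
∫ e_r ≤ 4·ke`; `inner_le` (per-instant bound for a non-positive constant multiplier, junk branch included);
`entropyFunctional_le`: on `Φ.good`, for a space-independent non-increasing test function `ψ` and horizon `1`,
`I(z) ≤ (ψ 0 - ψ 1)(1 + 4 ke z)` by energy conservation and the fundamental theorem of calculus.  There is no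
pathwise LOWER bound (cold balls, bare-`limsup` `f_ex`), which is why the crux is one-sided-robust to junk.
refuter-cdisprove-stmt-AtomisticToContinuum-13081-0.
-/

noncomputable section

namespace Summit.AtomisticToContinuum.HydrodynamicLimit.Theorems.LocalSecondLawNegative

open MeasureTheory Filter Set Topology
open scoped ENNReal
open Literature.MathematicalPhysics.KineticTheory Literature.Analysis.FluidPDE

/-! ## The pieces of the crux functional, as named definitions (defeq to the crux's `let`s) -/

/-- The cone mollifier `b_r(y, x₀) = 3/(π r³) (1 - d(y,x₀)/r)₊` of the crux (particle at `y`, field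
point `x₀`). [folklore] -/
def cone (r : ℝ) (y x₀ : T3) : ℝ :=
  3 / (Real.pi * r ^ 3) * max (1 - Torus.euclidDist y x₀ / r) 0

variable {N : ℕ}

/-- Mollified empirical density `ρ_r(x₀)` of a configuration. [folklore] -/
def rhoC (r : ℝ) (w : Config (N + 1) (Fin 3) T3) (x₀ : T3) : ℝ :=
  ∫ q, cone r q.1 x₀ ∂(empiricalMeasure w)

/-- Mollified empirical momentum `m_r(x₀)`. [folklore] -/
def momC (r : ℝ) (w : Config (N + 1) (Fin 3) T3) (x₀ : T3) : V3 :=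
  ∫ q, cone r q.1 x₀ • q.2 ∂(empiricalMeasure w)

/-- Mollified empirical kinetic energy `e_r(x₀)`. [folklore] -/
def kinC (r : ℝ) (w : Config (N + 1) (Fin 3) T3) (x₀ : T3) : ℝ :=
  ∫ q, cone r q.1 x₀ * (‖q.2‖ ^ 2 / 2) ∂(empiricalMeasure w)

/-- Empirical temperature `θ_r = (2/3)(e_r/ρ_r - |m_r|²/(2ρ_r²))`. [folklore] -/
def thetaC (r : ℝ) (w : Config (N + 1) (Fin 3) T3) (x₀ : T3) : ℝ :=
  2 / 3 * (kinC r w x₀ / rhoC r w x₀ - ‖momC r w x₀‖ ^ 2 / (2 * rhoC r w x₀ ^ 2))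

/-- The guarded mathematical entropy `H(ρ,θ) = -ρ(3/2 log θ - log ρ - f_ex(ρσ³))` of the crux
(`0` off `{ρ > 0, θ > 0}`). [folklore] -/
def Hs (σ a b : ℝ) : ℝ :=
  if 0 < a ∧ 0 < b then -(a * (3 / 2 * Real.log b - Real.log a - hsExcessFreeEnergy (a * σ ^ 3))) else 0

/-- Mean kinetic energy per particle `(N+1)⁻¹ ∑ |vᵢ|²/2`. [folklore] -/
def ke (w : Config (N + 1) (Fin 3) T3) : ℝ :=
  ((N + 1 : ℕ) : ℝ)⁻¹ * ∑ i, ‖(w i).2‖ ^ 2 / 2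

/-- The crux's space–time entropy functional `I(z) = ∫₀^τ ∫ H(ρ_r,θ_r)(∂ₛφ + (m_r/ρ_r)·∇φ)` along
the flow `Φ`. [folklore] -/
def entropyFunctional (σ r τ : ℝ) (φ : ℝ → T3 → ℝ)
    (Φ : HardSphereFlow (Torus.geometry (Fin 3)) (hsDiameter σ N) (N + 1))
    (z : Config (N + 1) (Fin 3) T3) : ℝ :=
  ∫ s in Set.Icc (0 : ℝ) τ, ∫ x : T3,
    Hs σ (rhoC r (Φ.flow s z) x) (thetaC r (Φ.flow s z) x) *
      (deriv (fun s' => φ s' x) s +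
        ∑ k : Fin 3, (momC r (Φ.flow s z) x) k / rhoC r (Φ.flow s z) x *
          Literature.Analysis.FunctionSpaces.Torus.partialDeriv k (φ s) x)

/-! ## Elementary bounds -/

/-- `f_ex ≥ 0`: every term `-N⁻¹ log Q_N` is `≥ 0` (`Q_N ≤ 1`), and a real `limsup` of
non-negative terms is `≥ 0` (also in the junk case `sInf ∅ = 0`). [folklore] -/
theorem hsExcessFreeEnergy_nonneg (η : ℝ) : 0 ≤ hsExcessFreeEnergy η := by
  unfold hsExcessFreeEnergy
  have hterm : ∀ n : ℕ, 0 ≤ -(n : ℝ)⁻¹ * Real.log (hsFreeVolume η n) := by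
    intro n
    have h1 : Real.log (hsFreeVolume η n) ≤ 0 :=
      Real.log_nonpos ENNReal.toReal_nonneg (hsFreeVolume_le_one η n)
    have h2 : 0 ≤ (n : ℝ)⁻¹ := by positivity
    nlinarith
  rw [Filter.limsup_eq]
  refine Real.sInf_nonneg ?_
  intro a ha
  obtain ⟨n, hn⟩ := ha.exists
  exact (hterm n).trans hn

/-- `a log a ≥ -1` for `a > 0` (from `1 - a⁻¹ ≤ log a`). [folklore] -/
theorem mul_log_ge_neg_one {a : ℝ} (ha : 0 < a) : -1 ≤ a * Real.log a := by
  have h := Real.one_sub_inv_le_log_of_pos ha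
  have : a * (1 - a⁻¹) = a - 1 := by field_simp
  nlinarith [mul_le_mul_of_nonneg_left h ha.le]

/-- **Lower bound of the guarded entropy density by the kinetic energy density.**  If
`θ = (2/3)(e/ρ - m²/(2ρ²))` with `e ≥ 0`, then `H(ρ, θ) ≥ -1 - e`; both the guard branch and the
junk branch satisfy it (`ρ log ρ ≥ -1`, `ρ f_ex ≥ 0`, `(3/2)ρ log θ ≤ (3/2)ρθ ≤ e`). [folklore] -/
theorem Hs_ge (σ : ℝ) {a e m2 : ℝ} (he : 0 ≤ e) (hm2 : 0 ≤ m2) :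
    -1 - e ≤ Hs σ a (2 / 3 * (e / a - m2 / (2 * a ^ 2))) := by
  unfold Hs
  split_ifs with h
  · obtain ⟨ha, hb⟩ := h
    set b := 2 / 3 * (e / a - m2 / (2 * a ^ 2)) with hbdef
    have h1 : -1 ≤ a * Real.log a := mul_log_ge_neg_one ha
    have h2 : 0 ≤ a * hsExcessFreeEnergy (a * σ ^ 3) :=
      mul_nonneg ha.le (hsExcessFreeEnergy_nonneg _)
    have h3 : Real.log b ≤ b - 1 := Real.log_le_sub_one_of_pos hb
    have h4 : a * b ≤ 2 / 3 * e := by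
      have : a * b = 2 / 3 * (e - m2 / (2 * a)) := by
        rw [hbdef]; field_simp
      rw [this]
      have : 0 ≤ m2 / (2 * a) := by positivity
      nlinarith
    have h5 : a * Real.log b ≤ a * (b - 1) := mul_le_mul_of_nonneg_left h3 ha.le
    nlinarith
  · linarith

/-! ## The cone kernel -/

/-- The cone kernel is non-negative. [folklore] -/
theorem cone_nonneg {r : ℝ} (hr : 0 < r) (y x₀ : T3) : 0 ≤ cone r y x₀ := by
  unfold cone; positivity

/-- The cone kernel is dominated by `3/(πr³)` times the indicator of the minimal-image `r`-ball. [folklore] -/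
theorem cone_le {r : ℝ} (hr : 0 < r) (y x₀ : T3) : cone r y x₀ ≤ 3 / (Real.pi * r ^ 3) *
    ({x | Torus.euclidDist x y < r} : Set T3).indicator (fun _ => (1 : ℝ)) x₀ := by
  unfold cone
  refine mul_le_mul_of_nonneg_left ?_ (by positivity)
  by_cases hx : Torus.euclidDist x₀ y < r
  · rw [Set.indicator_of_mem (show x₀ ∈ {x | Torus.euclidDist x y < r} from hx)]
    refine max_le ?_ zero_le_one
    have : 0 ≤ Torus.euclidDist y x₀ / r := by
      rw [Torus.euclidDist_eq]; positivity
    linarith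
  · rw [Set.indicator_of_notMem (show x₀ ∉ {x | Torus.euclidDist x y < r} from hx)]
    refine max_le ?_ le_rfl
    rw [not_lt, Torus.euclidDist_comm] at hx
    have : 1 ≤ Torus.euclidDist y x₀ / r := by rwa [le_div_iff₀ hr, one_mul]
    linarith

/-- The cone kernel is continuous in the field point (the minimal-image distance is continuous). [folklore] -/
theorem continuous_cone (r : ℝ) (y : T3) : Continuous (cone r y) := by
  unfold cone
  refine continuous_const.mul ((continuous_const.sub ?_).max continuous_const)
  refine Continuous.div_const ?_ _
  show Continuous fun x₀ => ‖Torus.reprSym (y - x₀)‖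
  exact Torus.continuous_norm_reprSym.comp (continuous_const.sub continuous_id)

/-- Minimal-image balls are open. [folklore] -/
theorem isOpen_ball_euclidDist (y : T3) (r : ℝ) : IsOpen {x : T3 | Torus.euclidDist x y < r} := by
  have hc : Continuous fun x : T3 => Torus.euclidDist x y := by
    simp_rw [Torus.euclidDist_eq]
    exact Torus.continuous_norm_reprSym.comp (continuous_id.sub continuous_const)
  exact isOpen_lt hc continuous_const

/-- `∫ b_r(y, ·) ≤ 4` for `0 < r < 1/2`: the kernel is at most `3/(πr³)` on the minimal-image ball
of radius `r`, whose Haar measure is `(4/3)πr³` (`Torus.volume_euclidDist_lt`). [folklore] -/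
theorem integral_cone_le {r : ℝ} (hr : 0 < r) (hr2 : r < 1 / 2) (y : T3) :
    ∫ x₀, cone r y x₀ ≤ 4 := by
  have hmeas : MeasurableSet ({x | Torus.euclidDist x y < r} : Set T3) :=
    (isOpen_ball_euclidDist y r).measurableSet
  have hvol : (volume ({x | Torus.euclidDist x y < r} : Set T3)).toReal = r ^ 3 * (Real.pi * 4 / 3) := by
    rw [Torus.volume_euclidDist_lt hr2 y, EuclideanSpace.volume_ball_fin_three, ENNReal.toReal_mul,
      ← ENNReal.ofReal_pow hr.le, ENNReal.toReal_ofReal (by positivity),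
      ENNReal.toReal_ofReal (by positivity)]
  calc ∫ x₀, cone r y x₀
      ≤ ∫ x₀, 3 / (Real.pi * r ^ 3) *
          ({x | Torus.euclidDist x y < r} : Set T3).indicator (fun _ => (1 : ℝ)) x₀ := by
        refine integral_mono (integrable_of_continuous_T3 (continuous_cone r y))
          ((integrable_const (1 : ℝ)).indicator hmeas |>.const_mul _) fun x₀ => cone_le hr y x₀
    _ = 3 / (Real.pi * r ^ 3) * (r ^ 3 * (Real.pi * 4 / 3)) := by
        rw [integral_const_mul, integral_indicator_const _ hmeas, smul_eq_mul, mul_one,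
          Measure.real, hvol]
    _ = 4 := by field_simp


/-! ## Configuration-level identities -/

/-- The mollified kinetic energy as a finite sum over particles. [folklore] -/
theorem kinC_eq_sum (r : ℝ) (w : Config (N + 1) (Fin 3) T3) (x₀ : T3) :
    kinC r w x₀ = ((N + 1 : ℕ) : ℝ)⁻¹ * ∑ i, cone r (w i).1 x₀ * (‖(w i).2‖ ^ 2 / 2) := by
  unfold kinC
  rw [integral_empiricalMeasure]

/-- The mollified kinetic energy is non-negative. [folklore] -/
theorem kinC_nonneg {r : ℝ} (hr : 0 < r) (w : Config (N + 1) (Fin 3) T3) (x₀ : T3) :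
    0 ≤ kinC r w x₀ := by
  rw [kinC_eq_sum]
  refine mul_nonneg (by positivity) (Finset.sum_nonneg fun i _ => ?_)
  exact mul_nonneg (cone_nonneg hr _ _) (by positivity)

/-- The mollified kinetic energy is continuous in the field point. [folklore] -/
theorem continuous_kinC (r : ℝ) (w : Config (N + 1) (Fin 3) T3) : Continuous (kinC r w) := by
  have : kinC r w = fun x₀ => ((N + 1 : ℕ) : ℝ)⁻¹ * ∑ i, cone r (w i).1 x₀ * (‖(w i).2‖ ^ 2 / 2) :=
    funext fun x₀ => kinC_eq_sum r w x₀
  rw [this]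
  exact continuous_const.mul (continuous_finsetSum _ fun i _ => (continuous_cone r _).mul continuous_const)

/-- The mean kinetic energy is non-negative. [folklore] -/
theorem ke_nonneg (w : Config (N + 1) (Fin 3) T3) : 0 ≤ ke w := by
  unfold ke; positivity

/-- `∫ e_r ≤ 4 · ke`: exchange the finite sum with the `x₀`-integral and use `∫ b_r ≤ 4`. [folklore] -/
theorem integral_kinC_le {r : ℝ} (hr : 0 < r) (hr2 : r < 1 / 2) (w : Config (N + 1) (Fin 3) T3) :
    ∫ x₀, kinC r w x₀ ≤ 4 * ke w := by
  have hfun : kinC r w = fun x₀ => ((N + 1 : ℕ) : ℝ)⁻¹ * ∑ i, cone r (w i).1 x₀ * (‖(w i).2‖ ^ 2 / 2) :=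
    funext fun x₀ => kinC_eq_sum r w x₀
  rw [hfun, integral_const_mul,
    integral_finsetSum Finset.univ (f := fun i a => cone r (w i).1 a * (‖(w i).2‖ ^ 2 / 2))
      (fun i _ => integrable_of_continuous_T3 ((continuous_cone r _).mul continuous_const))]
  have hsum : ∑ i, ∫ a, cone r (w i).1 a * (‖(w i).2‖ ^ 2 / 2) ≤ ∑ i, 4 * (‖(w i).2‖ ^ 2 / 2) := by
    refine Finset.sum_le_sum fun i _ => ?_
    rw [integral_mul_const]
    have h4 := integral_cone_le hr hr2 (w i).1
    have hv : 0 ≤ ‖(w i).2‖ ^ 2 / 2 := by positivity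
    exact mul_le_mul_of_nonneg_right h4 hv
  have hN : 0 ≤ ((N + 1 : ℕ) : ℝ)⁻¹ := by positivity
  unfold ke
  calc ((N + 1 : ℕ) : ℝ)⁻¹ * ∑ i, ∫ a, cone r (w i).1 a * (‖(w i).2‖ ^ 2 / 2)
      ≤ ((N + 1 : ℕ) : ℝ)⁻¹ * ∑ i, 4 * (‖(w i).2‖ ^ 2 / 2) := mul_le_mul_of_nonneg_left hsum hN
    _ = 4 * (((N + 1 : ℕ) : ℝ)⁻¹ * ∑ i, ‖(w i).2‖ ^ 2 / 2) := by
      rw [← Finset.mul_sum Finset.univ (fun i => ‖(w i).2‖ ^ 2 / 2) (4 : ℝ)]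
      ring

/-- **Per-instant bound.** For a non-positive constant multiplier `c` (the time derivative of a
non-increasing, space-independent test function) the inner integral of the crux functional is at
most `-c (1 + 4 ke)`, whether or not the integrand is Bochner-integrable. [folklore] -/
theorem inner_le {r : ℝ} (hr : 0 < r) (hr2 : r < 1 / 2) (σ : ℝ) (w : Config (N + 1) (Fin 3) T3)
    {c : ℝ} (hc : c ≤ 0) :
    ∫ x₀, Hs σ (rhoC r w x₀) (thetaC r w x₀) * c ≤ -c * (1 + 4 * ke w) := by
  have hpt : ∀ x₀, Hs σ (rhoC r w x₀) (thetaC r w x₀) * c ≤ (1 + kinC r w x₀) * (-c) := by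
    intro x₀
    have h : -1 - kinC r w x₀ ≤ Hs σ (rhoC r w x₀) (thetaC r w x₀) :=
      Hs_ge σ (kinC_nonneg hr w x₀) (sq_nonneg ‖momC r w x₀‖)
    nlinarith
  have hke := ke_nonneg w
  by_cases hint : Integrable (fun x₀ => Hs σ (rhoC r w x₀) (thetaC r w x₀) * c)
  · calc ∫ x₀, Hs σ (rhoC r w x₀) (thetaC r w x₀) * c
        ≤ ∫ x₀, (1 + kinC r w x₀) * (-c) :=
          integral_mono hint (((integrable_const (1 : ℝ)).add
            (integrable_of_continuous_T3 (continuous_kinC r w))).mul_const _) hpt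
      _ = (1 + ∫ x₀, kinC r w x₀) * (-c) := by
          rw [integral_mul_const, integral_add (integrable_const _)
            (integrable_of_continuous_T3 (continuous_kinC r w))]
          simp
      _ ≤ (1 + 4 * ke w) * (-c) := by
          have := integral_kinC_le hr hr2 w
          have hc' : 0 ≤ -c := by linarith
          gcongr
      _ = -c * (1 + 4 * ke w) := by ring
  · rw [integral_undef hint]
    nlinarith

/-! ## The functional along the flow, for a space-independent non-increasing test function -/

/-- Conservation of the mean kinetic energy along the flow on the good set
(`IsHardSphereTrajectory.configEnergy_eq_holds`). [folklore] -/
theorem ke_flow_eq {σ : ℝ} (Φ : HardSphereFlow (Torus.geometry (Fin 3)) (hsDiameter σ N) (N + 1))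
    {z : Config (N + 1) (Fin 3) T3} (hz : z ∈ Φ.good) (s : ℝ) : ke (Φ.flow s z) = ke z := by
  have h : configEnergy (Φ.flow s z) = configEnergy (Φ.flow 0 z) :=
    IsHardSphereTrajectory.configEnergy_eq_holds (Φ.isTrajectory z hz) s 0
  rw [Φ.flow_zero z hz] at h
  have hke : ∀ w : Config (N + 1) (Fin 3) T3, ke w = ((N + 1 : ℕ) : ℝ)⁻¹ * configEnergy w := by
    intro w
    unfold ke configEnergy
    rw [← Finset.sum_div]
    ring
  rw [hke, hke, h]

/-- **Pathwise upper bound of the entropy functional.**  On the good set, for the test function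
`φ(s, x) = ψ(s)` with `ψ` differentiable, `ψ'` continuous and `ψ` non-increasing,
`I(z) ≤ (ψ 0 - ψ 1)(1 + 4 ke(z))` (horizon `τ = 1`): energy conservation turns the per-instant
bound into a constant and the fundamental theorem of calculus integrates `-ψ'`; the junk branches
of both Bochner integrals satisfy the bound trivially. [folklore] -/
theorem entropyFunctional_le {σ r : ℝ} (hr : 0 < r) (hr2 : r < 1 / 2)
    (Φ : HardSphereFlow (Torus.geometry (Fin 3)) (hsDiameter σ N) (N + 1))
    {ψ : ℝ → ℝ} (hψd : Differentiable ℝ ψ) (hψc : Continuous (deriv ψ)) (hanti : Antitone ψ)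
    {z : Config (N + 1) (Fin 3) T3} (hz : z ∈ Φ.good) :
    entropyFunctional σ r 1 (fun s _ => ψ s) Φ z ≤ (ψ 0 - ψ 1) * (1 + 4 * ke z) := by
  have hpd : ∀ (k : Fin 3) (s : ℝ) (x : T3),
      Literature.Analysis.FunctionSpaces.Torus.partialDeriv k (fun _ : T3 => ψ s) x = 0 := by
    intro k s x
    simp [Literature.Analysis.FunctionSpaces.Torus.partialDeriv,
      Literature.Analysis.FunctionSpaces.Torus.lineDeriv]
  unfold entropyFunctional
  simp only [hpd, mul_zero, Finset.sum_const_zero, add_zero]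
  have hG : ∀ s, ∫ x, Hs σ (rhoC r (Φ.flow s z) x) (thetaC r (Φ.flow s z) x) * deriv ψ s ≤
      -deriv ψ s * (1 + 4 * ke z) := fun s => by
    rw [← ke_flow_eq Φ hz s]
    exact inner_le hr hr2 σ _ hanti.deriv_nonpos
  have hK : 0 ≤ 1 + 4 * ke z := by have := ke_nonneg z; positivity
  have hFTC : ∫ s in Set.Icc (0 : ℝ) 1, -deriv ψ s * (1 + 4 * ke z) = (ψ 0 - ψ 1) * (1 + 4 * ke z) := by
    rw [integral_Icc_eq_integral_Ioc, ← intervalIntegral.integral_of_le zero_le_one,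
      intervalIntegral.integral_mul_const, intervalIntegral.integral_neg,
      intervalIntegral.integral_deriv_eq_sub (fun x _ => hψd x) (hψc.intervalIntegrable _ _)]
    ring
  by_cases hint : IntegrableOn
      (fun s => ∫ x, Hs σ (rhoC r (Φ.flow s z) x) (thetaC r (Φ.flow s z) x) * deriv ψ s)
      (Set.Icc (0 : ℝ) 1)
  · calc ∫ s in Set.Icc (0 : ℝ) 1, ∫ x, Hs σ (rhoC r (Φ.flow s z) x) (thetaC r (Φ.flow s z) x) * deriv ψ s
        ≤ ∫ s in Set.Icc (0 : ℝ) 1, -deriv ψ s * (1 + 4 * ke z) :=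
          integral_mono hint ((hψc.neg.mul continuous_const).integrableOn_Icc) hG
      _ = (ψ 0 - ψ 1) * (1 + 4 * ke z) := hFTC
  · rw [integral_undef hint]
    exact mul_nonneg (sub_nonneg.2 (hanti zero_le_one)) hK


end Summit.AtomisticToContinuum.HydrodynamicLimit.Theorems.LocalSecondLawNegative

end
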